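import Literature.NumberTheory.Automorphic.TorusCharacterLocalComponents
import Literature.NumberTheory.Rogawski1990.XiLocalCharacter
import Literature.NumberTheory.Automorphic.UnitaryGroupBorelPair
import HarnessLib

/-!
# Local Hilbert 90 in the block model `E_v = ∏_{w ∣ v} E_w` and SURJECTIVITY OF `det : U(Φ_N)(F_v) → E¹_v` (N = 1, 2)
# (Cassels–Fröhlich Ch. VII §7.4 Cor. (a); Rogawski 1990 §1.9–§1.10, §3.13)

Topic `NumberTheory/Automorphic`; namespace `Literature.NumberTheory.Automorphic.UnitaryGroup`.  PROOF FILE (theorems only; no definition,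
no named fact, no instance, no notation, no `sorry`).  Setting of ★ `TorusCharacterLocalComponents` ∕ ★ `XiLocalCharacter`: a quadratic
extension of number fields `E/F` (`h2 : [E : F] = 2`) with non-trivial automorphism `c`, a finite place `v` of `F`, the block
`E_v = LocalRing E v = ∏_{w ∣ v} E_w` with the conjugation `c ⊗ 1 = conjLocal E c v`, the local norm-one torus
`E¹_v = normOneUnits (conjLocal E c v) = {t : (c ⊗ 1)(t) · t = 1}`, and the local unitary groups `U(Φ_N)(F_v)` of the anti-diagonal
forms with their determinant `localDet : U(Φ_N)(F_v) →* E¹_v` (★ `XiLocalCharacter`).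

* §1 **Local Hilbert 90 in the block model**: every `t ∈ E¹_v` is `(c ⊗ 1)(a) / a` for a unit `a` of `E_v`
  (`exists_map_conjLocal_div_eq_of_mem_normOneUnits`) — the `v`-block of the tree's IDELIC Hilbert 90
  ★ `TorusDict.exists_twist_eq_of_mem_torus` (`c • y / y = z` for `z` in the adelic torus), read through the block inclusion
  ★ `semilocalUnits` (`semilocalUnits_mem_torus`) and the block projection `y ↦ (y_w)_{w ∣ v}` (★ `adeleToLocal`), which intertwines `c •`
  with `c ⊗ 1` (★ `IdeleHerbrand.snd_smul_apply` ∕ ★ `conjLocal_apply`, both `rfl`).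
* §2 **`det` is ONTO `E¹_v`** for the CM frames of the Hodge-CM programme (`L` CM, `F = L⁺`, forms `Φ_N = antidiag(1,…,1)`):
  `N = 1`: `U(Φ₁)(L⁺_v) = E¹_v` itself, `det (t) = t` (`localDet_one_surjective`); `N = 2`: `diag(a, (σ a)⁻¹) ∈ U(Φ₂)(L⁺_v)` (★
  `glDiagonal_mem_unitaryGroupOfForm_antidiagonal_iff`, ★ `cmLocalForm_eq_over`) has determinant `a / σ a`, and §1 makes every `t ∈ E¹_v` of that
  form (`localDet_two_surjective`).
USE (crux H413 line LH7, (PK-A-H) rigidity of character packets on `H = U(Φ₂) × U(Φ₁)`): the local character `ξ_v(h₀, u) = η_v(det h₀) ψ_v(det h₀ · u)`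
(★ `xiLocalChar_apply_eq`) determines `(η_v, ψ_v)` once `det` is onto — ★ `OneDimAutRepHCofiniteRigidity`.

## References
* J. W. S. Cassels, A. Fröhlich (eds.), *Algebraic Number Theory* (1967), Ch. VII (Tate) §7.4 Cor. (a) (`H¹(G, J_L) = 0` and its local
  blocks) [CasselsFrohlichANT1967].
* J. Rogawski, *Automorphic Representations of Unitary Groups in Three Variables* (1990), §1.9–§1.10 pp. 8–9 (the maximal torus
  `d = (a, b, σ(a)⁻¹)`), §3.13 (the determinant on `U`) [Rogawski1990].
-/

set_option autoImplicit false

noncomputable section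

open NumberField IsDedekindDomain
open Literature.NumberTheory.GaloisRepresentations
open Literature.NumberTheory.Automorphic.Arthur2013.Leaves.TECR
open Literature.LinearAlgebra.Matrix

namespace Literature.NumberTheory.Automorphic

namespace UnitaryGroup

/-! ## §1 Local Hilbert 90 in the block model `∏_{w ∣ v} E_w` -/

section H90

variable {F : Type} (E : Type) [Field F] [NumberField F] [Field E] [NumberField E] [Algebra F E]
  (c : E ≃ₐ[F] E) (h2 : Module.finrank F E = 2) (hc : c ≠ 1) {v : HeightOneSpectrum (𝓞 F)}

/-- The block projection `𝕀_E → (∏_{w ∣ v} E_w)ˣ` intertwines the Galois action `c •` on idèles with the conjugation `c ⊗ 1` of the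
block (componentwise both are `c_w (y_{c⁻¹ w})`; ★ `IdeleHerbrand.snd_smul_apply`, ★ `conjLocal_apply`). [cite: CasselsFrohlichANT1967, Ch. VII §1.1] -/
theorem map_adeleToLocal_smul (y : ideleGroup E) :
    Units.map (adeleToLocal E v : AdeleRing (𝓞 E) E →+* LocalRing E v).toMonoidHom (c • y) =
      Units.map (conjLocal E c v : LocalRing E v →+* LocalRing E v).toMonoidHom
        (Units.map (adeleToLocal E v : AdeleRing (𝓞 E) E →+* LocalRing E v).toMonoidHom y) := by
  refine Units.ext (funext fun w => ?_)
  rfl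

/-- The block projection of the block inclusion is the identity: `(semilocalUnits v t)_w = t_w` for `w ∣ v`. [cite: TateThesis1967, §3.2] -/
theorem map_adeleToLocal_semilocalUnits (t : (LocalRing E v)ˣ) :
    Units.map (adeleToLocal E v : AdeleRing (𝓞 E) E →+* LocalRing E v).toMonoidHom (semilocalUnits E v t) = t := by
  refine Units.ext (funext fun w => ?_)
  change ((semilocalUnits E v t : ideleGroup E) : AdeleRing (𝓞 E) E).2 w.1 = (t : LocalRing E v) w
  exact semilocalUnits_snd_apply_of_over E t w

include h2 hc in
/-- **LOCAL HILBERT 90 IN THE BLOCK MODEL**: every norm-one unit `t` of `E_v = ∏_{w ∣ v} E_w` (`(c ⊗ 1)(t) · t = 1`) is a twist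
`(c ⊗ 1)(a) / a` of a unit `a` of `E_v` — the `v`-block of the idelic Hilbert 90 ★ `TorusDict.exists_twist_eq_of_mem_torus` applied to the idèle
`semilocalUnits v t ∈ T(𝔸_F)`. [cite: CasselsFrohlichANT1967, Ch. VII §7.4 Cor. (a)] -/
theorem exists_map_conjLocal_div_eq_of_mem_normOneUnits {t : (LocalRing E v)ˣ} (ht : t ∈ normOneUnits (conjLocal E c v)) :
    ∃ a : (LocalRing E v)ˣ, Units.map (conjLocal E c v : LocalRing E v →+* LocalRing E v).toMonoidHom a / a = t := by
  obtain ⟨y, hy⟩ := TorusDict.exists_twist_eq_of_mem_torus c h2 hc (semilocalUnits_mem_torus E c ht)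
  refine ⟨Units.map (adeleToLocal E v : AdeleRing (𝓞 E) E →+* LocalRing E v).toMonoidHom y, ?_⟩
  rw [← map_adeleToLocal_smul, ← map_div, ← Herbrand.twist_apply, hy, map_adeleToLocal_semilocalUnits]

include h2 hc in
/-- The same with the twist written `a / (c ⊗ 1)(a)` (replace `a` by `a⁻¹`). [cite: CasselsFrohlichANT1967, Ch. VII §7.4 Cor. (a)] -/
theorem exists_div_map_conjLocal_eq_of_mem_normOneUnits {t : (LocalRing E v)ˣ} (ht : t ∈ normOneUnits (conjLocal E c v)) :
    ∃ a : (LocalRing E v)ˣ, a / Units.map (conjLocal E c v : LocalRing E v →+* LocalRing E v).toMonoidHom a = t := by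
  obtain ⟨a, ha⟩ := exists_map_conjLocal_div_eq_of_mem_normOneUnits E c h2 hc ht
  refine ⟨a⁻¹, ?_⟩
  rw [map_inv, inv_div_inv, ha]

end H90

/-! ## §2 `det : U(Φ_N)(L⁺_v) → E¹_v` is onto, `N = 1, 2` (CM frames) -/

section Det

open Literature.NumberTheory.Rogawski1990

variable (L : Type) [Field L] [NumberField L] [IsCMField L] (v : HeightOneSpectrum (𝓞 ↥(maximalRealSubfield L)))

/-- **`N = 1`: `det : U(Φ₁)(L⁺_v) → E¹_v` is onto** — the scalar `diag(t)` lies in `U(Φ₁)` for every norm-one `t` and has determinant `t`.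
[cite: Rogawski1990, §1.9 p. 8; §3.13] -/
theorem localDet_one_surjective :
    Function.Surjective (localDet (IsCMField.complexConj L) v (isUnit_antidiagOne_det L 1)) := by
  intro t
  have hmem : glDiagonal 1 (LocalRing L v) (fun _ => (t : (LocalRing L v)ˣ)) ∈
      unitaryGroupOfForm (conjLocal L (IsCMField.complexConj L) v) (cmLocalForm L 1 v) := by
    rw [cmLocalForm_eq_over, glDiagonal_mem_unitaryGroupOfForm_antidiagonal_iff]
    intro i
    exact (mem_normOneUnits_iff _).1 t.2
  let g : ↥(unitaryGroupOfForm (conjLocal L (IsCMField.complexConj L) v) (cmLocalForm L 1 v)) :=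
    ⟨glDiagonal 1 (LocalRing L v) (fun _ => (t : (LocalRing L v)ˣ)), hmem⟩
  refine ⟨g, Subtype.ext (Units.ext ?_)⟩
  rw [coe_coe_localDet]
  change (Units.val (glDiagonal 1 (LocalRing L v) (fun _ => (t : (LocalRing L v)ˣ)))).det = _
  rw [coe_glDiagonal, Matrix.det_diagonal, Fin.prod_univ_one]

/-- **`N = 2`: `det : U(Φ₂)(L⁺_v) → E¹_v` is onto** — `diag(a, (σ a)⁻¹) ∈ U(Φ₂)(L⁺_v)` (★ `glDiagonal_mem_unitaryGroupOfForm_antidiagonal_iff`)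
has determinant `a / σ a`, and by local Hilbert 90 (§1) every norm-one `t` is of this form. [cite: Rogawski1990, §1.9–§1.10 pp. 8–9; §3.13]
[cite: CasselsFrohlichANT1967, Ch. VII §7.4 Cor. (a)] -/
theorem localDet_two_surjective :
    Function.Surjective (localDet (IsCMField.complexConj L) v (isUnit_antidiagOne_det L 2)) := by
  intro t
  -- local Hilbert 90: `t = a / σ a`
  obtain ⟨a, ha⟩ := exists_div_map_conjLocal_eq_of_mem_normOneUnits L (IsCMField.complexConj L)
    (Algebra.IsQuadraticExtension.finrank_eq_two _ L) (IsCMField.complexConj_ne_one (K := L)) t.2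
  -- the torus element `diag(a, (σ a)⁻¹)`
  let σ : LocalRing L v →+* LocalRing L v := conjLocal L (IsCMField.complexConj L) v
  let d : Fin 2 → (LocalRing L v)ˣ := fun i => if i = 0 then a else (Units.map σ.toMonoidHom a)⁻¹
  have hσσ : ∀ u : (LocalRing L v)ˣ, Units.map σ.toMonoidHom (Units.map σ.toMonoidHom u) = u := fun u =>
    Units.ext (conjLocal_conjLocal_cm L v (u : LocalRing L v))
  have hd0 : d 0 = a := rfl
  have hd1 : d 1 = (Units.map σ.toMonoidHom a)⁻¹ := rfl
  have hmem : glDiagonal 2 (LocalRing L v) d ∈ unitaryGroupOfForm (conjLocal L (IsCMField.complexConj L) v) (cmLocalForm L 2 v) := by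
    rw [cmLocalForm_eq_over, glDiagonal_mem_unitaryGroupOfForm_antidiagonal_iff]
    intro i
    fin_cases i
    · -- `i = 0`, `rev 0 = 1`: `σ((σ a)⁻¹) · a = a⁻¹ a = 1`
      change σ ((d (Fin.rev 0) : (LocalRing L v)ˣ) : LocalRing L v) * (d 0 : LocalRing L v) = 1
      rw [show Fin.rev (0 : Fin 2) = 1 from rfl, hd1, hd0]
      change ((Units.map σ.toMonoidHom ((Units.map σ.toMonoidHom a)⁻¹) : (LocalRing L v)ˣ) : LocalRing L v) * (a : LocalRing L v) = 1
      rw [map_inv, hσσ, ← Units.val_mul, inv_mul_cancel, Units.val_one]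
    · -- `i = 1`, `rev 1 = 0`: `σ(a) · (σ a)⁻¹ = 1`
      change σ ((d (Fin.rev 1) : (LocalRing L v)ˣ) : LocalRing L v) * (d 1 : LocalRing L v) = 1
      rw [show Fin.rev (1 : Fin 2) = 0 from rfl, hd0, hd1]
      change ((Units.map σ.toMonoidHom a : (LocalRing L v)ˣ) : LocalRing L v) * (((Units.map σ.toMonoidHom a)⁻¹ : (LocalRing L v)ˣ) : LocalRing L v) = 1
      rw [← Units.val_mul, mul_inv_cancel, Units.val_one]
  let g : ↥(unitaryGroupOfForm (conjLocal L (IsCMField.complexConj L) v) (cmLocalForm L 2 v)) := ⟨glDiagonal 2 (LocalRing L v) d, hmem⟩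
  refine ⟨g, Subtype.ext (Units.ext ?_)⟩
  rw [coe_coe_localDet]
  change (Units.val (glDiagonal 2 (LocalRing L v) d)).det = _
  rw [coe_glDiagonal, Matrix.det_diagonal, Fin.prod_univ_two, hd0, hd1, ← Units.val_mul, ← div_eq_mul_inv, ha]

end Det

end UnitaryGroup

end Literature.NumberTheory.Automorphic

end
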